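import Summits.BirchSwinnertonDyer.BirchSwinnertonDyer.Theorems.EisensteinPrimesInertiaTorsionFiniteGeneric
import Summits.BirchSwinnertonDyer.Rank1Residual.Iwasawa.DatumSelmerLocalIndexFinite
import HarnessLib

/-!
# The `p`-torsion of `S^{Σ₀}_M(K_∞)/S_M(K_∞)` is finite for a GENERIC `p`-divisible discrete module
# (Greenberg–Vatsal 2000 §2 p. 20 — the finite-coset cover, generic port)

Cell `bsd-eis` (home `run/shared/lean/pub/bsd-eis/`), seat `bsd-eis-k5-c2` g11, crux 2
`GoodLatticeBDPValue` (stmt-BirchSwinnertonDyer-19032), line `halves`, OPTION (B0): the port of b2b's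
`Iwasawa/DatumSelmerLocalIndexFinite` §2 and `DatumSelmerNonPrimitiveInvariants` §1
(`finite_torsionBy_quotient_of_cover`), hard-wired to `E[p^∞]`, to a GENERIC discrete `Γ_K`-module
`M` (open stabilisers, `p`-divisible, `M[p]` finite of `p`-power order) and ANY Greenberg data `L`
above `p` — so that, for Keller–Yin's character modules `(F/𝒪)(θ)`, the finiteness of
`(H¹_{𝓕_nr^{Sf}}/H¹_{𝓕_nr})[p]` becomes a KERNEL theorem (the local half of "`𝓗_w(K_∞)` is
`Λ`-cotorsion for `w ∤ p`"), feeding `UnrSelmerImprimitiveFiniteness` (p569470).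

HONEST FRAMING: tool theorems only; any number field, any `ℤ_p`-extension `κ` (`H = ker κ`) with a
topological generator `γ`, any finite `S₀` whose members `v ∤ p` are FINITELY DECOMPOSED in `K_∞`
(`hD`); BSD is proved for no curve.

## What
* `exists_finset_forall_sub_mem_of_nsmul_mem` — a finite `F ⊆ S^{S₀}` meets every class `s + S` with
  `p s ∈ S` (detecting map into the finite product of the finite `p`-torsion sets of
  `H¹(inertiaIn H v, M)`, `EisensteinPrimesInertiaTorsionFiniteGeneric`).
* **`finite_torsionBy_quotient`** — `(S^{S₀}/S)[p]` is finite.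

References: Greenberg–Vatsal 2000 §2 pp. 16–17, 20–21 (arXiv:math/9906215); Greenberg LNM 1716 §1.
-/

set_option linter.dupNamespace false
set_option autoImplicit false

noncomputable section

open scoped Classical AddSubgroup

open CategoryTheory NumberField IsDedekindDomain Field
open Summit.BirchSwinnertonDyer.Rank1Residual Summit.BirchSwinnertonDyer.Rank1Residual.Iwasawa
open Literature.NumberTheory.EllipticCurves Literature.NumberTheory.EllipticCurves.GreenbergSelmer
  Literature.NumberTheory.EllipticCurves.GreenbergVatsal2000
  Literature.NumberTheory.GaloisRepresentations
open Summit.BirchSwinnertonDyer.BirchSwinnertonDyer.Theorems.InertiaTorsionFiniteGeneric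

universe u

namespace Summit.BirchSwinnertonDyer.BirchSwinnertonDyer.Theorems.DatumSelmerQuotientTorsionFiniteGeneric

variable {K : Type u} [Field K] [NumberField K] {M : Type u} [AddCommGroup M]
  [DistribMulAction (absoluteGaloisGroup K) M] [TopologicalSpace M] [DiscreteTopology M]
  {p : ℕ} [Fact p.Prime] (κ : ZpExtension K p) {γ : absoluteGaloisGroup K}

/-- **The `p`-torsion of `S^{Σ₀}_M(K_∞)/S_M(K_∞)` is finite, as a finite-coset cover** (generic
module; any Greenberg data `L`; any finite `S₀` whose members `v ∤ p` are finitely decomposed in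
`K_∞`): some finite `F ⊆ S^{S₀}` meets every class `s + S` with `s ∈ S^{S₀}`, `p s ∈ S`. The map
`c ↦ (res_{J_v} conj_{γⁿ} c)_{v, n < p^{m_v}}` into the finite product of the finite `p`-torsion sets of
`H¹(inertiaIn H v, M)` (`finite_setOf_nsmul_eq_zero_discreteH1_inertiaIn`, generic) detects
membership in `S` (`forall_conjH1_mem_unramifiedKer_of_forall_lt`). Port of the b2b theorem of the
same name. [cite: GreenbergVatsal2000, §2 pp. 17, 20–21] -/
theorem exists_finset_forall_sub_mem_of_nsmul_mem [Finite ↥(M[(p : ℤ)])]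
    (hcard : ∃ k : ℕ, Nat.card ↥(M[(p : ℤ)]) = p ^ k)
    (hdiv : ∀ m : M, ∃ m' : M, p • m' = m)
    (hstab : ∀ m : M,
      IsOpen (MulAction.stabilizer (absoluteGaloisGroup K) m : Set (absoluteGaloisGroup K)))
    (hγ : κ.IsTopGenerator γ) (L : Data K M p) (S₀ : Finset (HeightOneSpectrum (𝓞 K)))
    (hD : ∀ v ∈ S₀, ((p : ℕ) : 𝓞 K) ∉ v.asIdeal → ∃ δ ∈ decomp (K := K) v, κ δ ≠ 1) :
    ∃ F : Finset ↥(datumSelmerInfty κ M L (↑S₀ : Set (HeightOneSpectrum (𝓞 K)))),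
      ∀ s : ↥(datumSelmerInfty κ M L (↑S₀ : Set (HeightOneSpectrum (𝓞 K)))),
        p • (s : subgroupH1 κ.kerSubgroup M) ∈
            datumSelmerInfty κ M L (∅ : Set (HeightOneSpectrum (𝓞 K))) →
          ∃ f ∈ F, (s : subgroupH1 κ.kerSubgroup M) - (f : subgroupH1 κ.kerSubgroup M) ∈
            datumSelmerInfty κ M L (∅ : Set (HeightOneSpectrum (𝓞 K))) := by
  haveI : κ.kerSubgroup.Normal := by rw [ZpExtension.kerSubgroup]; infer_instance
  set H := κ.kerSubgroup with hH
  set SS := datumSelmerInfty κ M L (↑S₀ : Set (HeightOneSpectrum (𝓞 K))) with hSS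
  set S := datumSelmerInfty κ M L (∅ : Set (HeightOneSpectrum (𝓞 K))) with hS
  -- the relevant places and, at each, a bound on the number of conjugates to test
  let ι := {v : HeightOneSpectrum (𝓞 K) // v ∈ S₀ ∧ ((p : ℕ) : 𝓞 K) ∉ v.asIdeal}
  haveI : Finite ι := Finite.of_injective (fun i : ι ↦ (⟨i.1, i.2.1⟩ : (↑S₀ : Set _)))
    fun i j hij ↦ Subtype.ext (by simpa using congrArg Subtype.val hij)
  have hrep : ∀ i : ι, ∃ m : ℕ, ∀ σ : absoluteGaloisGroup K, ∃ n < p ^ m, ∃ δ ∈ decomp (K := K) i.1,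
      ∃ h ∈ H, σ = h * (δ * γ ^ n) := fun i ↦ by
    obtain ⟨δ₀, hδ₀, hne⟩ := hD i.1 i.2.1 i.2.2
    exact exists_forall_eq_mul_decomp_mul_pow κ hγ hδ₀ hne
  choose m hm using hrep
  -- the detecting map
  let Φ : subgroupH1 H M →+ (Π i : ι, Fin (p ^ m i) → discreteH1 (inertiaIn H i.1) M) :=
    AddMonoidHom.pi fun i ↦ AddMonoidHom.pi fun n ↦
      (resH1Hom (inertiaInToH H i.1) (AddMonoidHom.id M) fun _ _ ↦ rfl).comp
        (conjH1 H M (γ ^ (n : ℕ)))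
  have hΦ : ∀ (c : subgroupH1 H M) (i : ι) (n : Fin (p ^ m i)),
      Φ c i n = resH1Hom (inertiaInToH H i.1) (AddMonoidHom.id M) (fun _ _ ↦ rfl)
        (conjH1 H M (γ ^ (n : ℕ)) c) := fun _ _ _ ↦ rfl
  -- (a) `Φ` detects `S` inside `S^{S₀}`
  have hker : ∀ c ∈ SS, Φ c = 0 → c ∈ S := fun c hc h0 ↦ by
    rw [hS, mem_datumSelmerInfty_empty_iff κ M L (↑S₀ : Set _)]
    refine ⟨hc, fun v hv hpv σ ↦ ?_⟩
    refine forall_conjH1_mem_unramifiedKer_of_forall_lt κ M (hm ⟨v, hv, hpv⟩) (fun n hn ↦ ?_) σ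
    have h := congrFun (congrFun h0 ⟨v, hv, hpv⟩) ⟨n, hn⟩
    rw [hΦ] at h
    exact h
  -- (b) on `{s ∈ S^{S₀} | p s ∈ S}` it takes values in a finite set
  let T : Set (subgroupH1 H M) := {c | c ∈ SS ∧ p • c ∈ S}
  let P : Set (Π i : ι, Fin (p ^ m i) → discreteH1 (inertiaIn H i.1) M) :=
    {y | ∀ i n, p • y i n = 0}
  have hP : P.Finite := by
    have hfin : ∀ i : ι, Set.Finite {x : discreteH1 (inertiaIn H i.1) M | p • x = 0} := fun i ↦
      finite_setOf_nsmul_eq_zero_discreteH1_inertiaIn κ i.1 hcard hdiv hstab i.2.2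
    refine (Set.Finite.pi' fun i : ι ↦ Set.Finite.pi' fun _ : Fin (p ^ m i) ↦ hfin i).subset ?_
    intro y hy i n
    exact hy i n
  have hTP : Φ '' T ⊆ P := by
    rintro _ ⟨c, ⟨-, hpc⟩, rfl⟩ i n
    rw [← Pi.smul_apply, ← Pi.smul_apply, ← map_nsmul, hΦ]
    have hmem := ((mem_datumSelmerInfty_empty_iff κ M L (↑S₀ : Set _) (p • c)).1 hpc).2 i.1 i.2.1
      i.2.2 (γ ^ (n : ℕ))
    exact hmem
  have hfin : (Φ '' T).Finite := hP.subset hTP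
  -- choose representatives
  have hpre : ∀ y : hfin.toFinset, ∃ c ∈ T, Φ c = y := fun y ↦ by
    have hy := y.2
    rw [Set.Finite.mem_toFinset] at hy
    exact hy
  choose g hgT hgΦ using hpre
  refine ⟨Finset.univ.image fun y ↦ ⟨g y, (hgT y).1⟩, fun s hps ↦ ?_⟩
  have hsT : (s : subgroupH1 H M) ∈ T := ⟨s.2, hps⟩
  have hy : Φ s ∈ hfin.toFinset := by
    rw [Set.Finite.mem_toFinset]; exact ⟨_, hsT, rfl⟩
  refine ⟨⟨g ⟨Φ s, hy⟩, (hgT _).1⟩, Finset.mem_image_of_mem _ (Finset.mem_univ _), ?_⟩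
  refine hker _ (SS.sub_mem s.2 (hgT _).1) ?_
  rw [map_sub, hgΦ, sub_self]

/-- **`(S^{Σ₀}_M(K_∞)/S_M(K_∞))[p]` is FINITE** for a generic `p`-divisible discrete module `M` with
open stabilisers and finite `p`-torsion of `p`-power order, any Greenberg data `L`, any finite `S₀`
whose members `v ∤ p` are finitely decomposed in `K_∞` (from the finite-coset cover; port of b2b
`Iwasawa.finite_torsionBy_quotient_of_cover`). GV 2000 p. 20: "`S^{Σ₀}_A(ℚ_∞)/S_A(ℚ_∞) ≅
∏_{ℓ∈Σ₀} 𝓗_ℓ(ℚ_∞)` … `𝓗_ℓ(ℚ_∞)` is `Λ`-cotorsion", in the currency of `p`-torsion.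
[cite: GreenbergVatsal2000, §2 pp. 20–21 (arXiv:math/9906215)] -/
theorem finite_torsionBy_quotient [Finite ↥(M[(p : ℤ)])]
    (hcard : ∃ k : ℕ, Nat.card ↥(M[(p : ℤ)]) = p ^ k)
    (hdiv : ∀ m : M, ∃ m' : M, p • m' = m)
    (hstab : ∀ m : M,
      IsOpen (MulAction.stabilizer (absoluteGaloisGroup K) m : Set (absoluteGaloisGroup K)))
    (hγ : κ.IsTopGenerator γ) (L : Data K M p) (S₀ : Finset (HeightOneSpectrum (𝓞 K)))
    (hD : ∀ v ∈ S₀, ((p : ℕ) : 𝓞 K) ∉ v.asIdeal → ∃ δ ∈ decomp (K := K) v, κ δ ≠ 1) :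
    Finite ((↥(datumSelmerInfty κ M L (↑S₀ : Set (HeightOneSpectrum (𝓞 K)))) ⧸
      (datumSelmerInfty κ M L (∅ : Set (HeightOneSpectrum (𝓞 K)))).addSubgroupOf
        (datumSelmerInfty κ M L (↑S₀ : Set (HeightOneSpectrum (𝓞 K)))))[(p : ℤ)]) := by
  set SS := datumSelmerInfty κ M L (↑S₀ : Set (HeightOneSpectrum (𝓞 K))) with hSS
  set S := datumSelmerInfty κ M L (∅ : Set (HeightOneSpectrum (𝓞 K))) with hS
  set N : AddSubgroup SS := S.addSubgroupOf SS with hN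
  have hNmem : ∀ s : SS, s ∈ N ↔ (s : subgroupH1 κ.kerSubgroup M) ∈ S := fun s ↦
    AddSubgroup.mem_addSubgroupOf
  obtain ⟨F, hF⟩ := exists_finset_forall_sub_mem_of_nsmul_mem κ hcard hdiv hstab hγ L S₀ hD
  have hBp : Set.Finite (((SS ⧸ N)[(p : ℤ)] : AddSubgroup (SS ⧸ N)) : Set (SS ⧸ N)) := by
    refine ((F.finite_toSet).image (QuotientAddGroup.mk' N)).subset fun b hb ↦ ?_
    obtain ⟨s, rfl⟩ := QuotientAddGroup.mk'_surjective N b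
    have h1 : QuotientAddGroup.mk' N (p • s) = 0 := by
      rw [map_nsmul]; exact AddSubgroup.torsionBy.nsmul_iff.mp hb
    have hb' : p • s ∈ N := (QuotientAddGroup.eq_zero_iff _).mp h1
    have hps : p • (s : subgroupH1 κ.kerSubgroup M) ∈ S := by
      have h2 := (hNmem _).mp hb'
      rwa [AddSubgroupClass.coe_nsmul] at h2
    obtain ⟨f, hfF, hf⟩ := hF s hps
    refine ⟨f, Finset.mem_coe.2 hfF, ?_⟩
    rw [QuotientAddGroup.mk'_apply, QuotientAddGroup.mk'_apply, eq_comm,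
      QuotientAddGroup.eq_iff_sub_mem, hNmem, AddSubgroupClass.coe_sub]
    exact hf
  exact hBp.to_subtype

end Summit.BirchSwinnertonDyer.BirchSwinnertonDyer.Theorems.DatumSelmerQuotientTorsionFiniteGeneric

end
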